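import Literature.NumberTheory.EllipticCurves.LeadingTerm
import Literature.NumberTheory.EllipticCurves.AnalyticRank
import Literature.NumberTheory.EllipticCurves.MordellWeil
import HarnessLib
import HarnessLib.Audit
import HarnessLib.Audit.TribunalTags

/-!
# Strong-Hypothesis Library — summit `BirchSwinnertonDyer` (D-0034, skeleton)

The REGISTRY of known strong hypotheses `H` (open conjectures with `H ⇒ P` landed or printed) and of
known equivalent reformulations `E` (`E ↔ P` in print) for the single-problem summit
`BirchSwinnertonDyer`. Every entry carries `@[strong_hypothesis "BirchSwinnertonDyer.BirchSwinnertonDyer"]`;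
the kernel tribunal (`#h21_tribunal`, D-0033 T1 rule (a)) probes each registered `H` against a route
crux `C` for `H → C`. The bridges `H → P` live summit-side in
`Summits/BirchSwinnertonDyer/StrongHypotheses.lean`. Nothing already in the tree is restated: existing
conjecture `def`s are tagged in place with `attribute [strong_hypothesis …]`; the one NEW hypothesis
(`BSDRankConjectureNF`) is an OPEN statement (`OPEN CONJECTURE — … [status: open]`, CONVENTIONS §4)
carrying `@[conjecture]`, printed to be at least as strong as the summit, so it is not dischargeable
literature debt and has no `_holds` to expect.

## The problem

* `BirchSwinnertonDyer : Prop := Literature.BSDRankConjecture`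
  (`Summits/BirchSwinnertonDyer/BirchSwinnertonDyer/Statement.lean`) — the BSD **rank** conjecture
  (RANK; Wiles, Clay 2000; Tate 1974 Conj. 4a): for every Weierstrass equation `W` over `ℚ` with
  `Δ ≠ 0`, `W.analyticRank = W.mordellWeilRank`, i.e. `ord_{s=1} L(E,s) = rank_ℤ E(ℚ)` with `L(E,s)`
  the entire continuation `W.entireLFunction` (`WeierstrassCurve.analyticRank`, `…mordellWeilRank`).
  Only the rank clause is the summit; SHAFIN and the leading-term formula are not.

## Census (H ⇒ P known in print, or E ⇔ P)

| `H` / `E` | one-line statement | relation to RANK | source | status here | bridge (summit file) |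
|---|---|---|---|---|---|
| full (refined) BSD over `ℚ`, RANK ∧ SHAFIN ∧ LEAD | for every globally minimal elliptic `W/ℚ`: `r_an = rank`, `Ш` finite, `L^{(r)}(E,1)/r! = #Ш·Reg·Ω·∏c_p/#tors²` | strictly stronger (RANK is its first clause; restriction to globally minimal models is no loss: Néron 1964 / Silverman VIII.8.3 + isomorphism invariance of `r_an`, `rank`) | Wiles, Clay 2000, Conjecture + Remarks 1; Tate 1974 §1 Conj. 4; Silverman *AEC* C.16.5 | `registered`: `Literature.NumberTheory.EllipticCurves.BSDConjecture` (existing, `LeadingTerm.lean`) | LANDED: `Summit.BirchSwinnertonDyer.StrongHypotheses.bsdConjecture_implies_birchSwinnertonDyer` (composition of `hasGlobalMinimalModel_rat_holds`, `analyticRank_variableChange_holds`, `mordellWeilRank_variableChange_holds`) |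
| BSD rank conjecture over every number field | for every number field `K` and elliptic `W/K` whose `L(E/K,s)` is entire: `ord_{s=1} L(E/K,s) = rank_ℤ E(K)` | strictly stronger (case `K = ℚ`, where entire continuation is BCDT 2001 Thm. A) | Tate, Sém. Bourbaki 306 (1966), §1 Conj. (A) (abelian varieties over global fields, dimension 1); Gross, PCMS 18 (2011), Conj. 2.10 (1) | `registered`: `Literature.StrongHypotheses.BirchSwinnertonDyer.BSDRankConjectureNF` (NEW, below) | PRINTED: `Summit.BirchSwinnertonDyer.StrongHypotheses.BSDRankConjectureNFImpliesBirchSwinnertonDyer` (specialisation `K = ℚ` + the named fact `WeierstrassCurve.hasEntireLFunction_rat`, BCDT 2001 Thm. A, undischarged in tree) |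
| finiteness of `Ш(E/ℚ)` for all `E/ℚ` (SHAFIN) | `∀ W/ℚ` elliptic, `Finite W.sha` | INCOMPARABLE — a clause of full BSD; does NOT imply RANK in print (with Dokchitser–Dokchitser 2010 Thm. 1.4 it gives the parity conjecture, and `rank = corank Sel_{p^∞}`, not `r_an`) | Tate 1974 Conj. 1; Silverman *AEC* Conj. X.4.13 | in tree (`Literature.NumberTheory.EllipticCurves.ShaFiniteConjecture`, `…ShaFiniteConjectureNF K`, `WeierstrassCurve.ShaFinite W`), deliberately NOT registered | none |
| BSD leading-term formula (LEAD, given `Ш` finite) | `∀` globally minimal elliptic `W/ℚ`, `Finite W.sha → W.leadingLCoeff = W.bsdRHS` | INCOMPARABLE with RANK (predicts the `r_an`-th coefficient; forces no equality of ranks) | Wiles, Clay 2000, Remarks 1; Gross PCMS Conj. 2.10 (2) | in tree (`Literature.NumberTheory.EllipticCurves.BSDLeadingTermConjecture`), NOT registered | none |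
| `p`-adic BSD (Mazur–Tate–Teitelbaum), good ordinary non-exceptional | `ord_{T=0} L_p(E,T) = rank E(ℚ)` (+ leading term) | INCOMPARABLE in print (relates `rank` to the order of the `p`-adic, not the complex, `L`-function; no printed passage `ord L_p = ord L` beyond `r ≤ 1`) | Mazur–Tate–Teitelbaum, Invent. Math. 84 (1986), §II.10 | in tree as a PARAMETRISED predicate `Literature.NumberTheory.EllipticCurves.PAdicBSDConjecture W p D` (over a `p`-adic height datum `D`; `PAdicBSD.lean`, review caveat: `∀ D` would be false), NOT registered | none |
| parity conjecture | `(-1)^{rank E(ℚ)} = w(E)` | WEAKER (consequence of RANK via `even_analyticRank_iff_rootNumber_eq_one`) | Dokchitser, *Notes on the parity conjecture* (2013) §1.1 | no closed decl (the `p`-parity THEOREM is `WeierstrassCurve.p_parity`, `BSDSelmer.lean`); NOT registered (weaker) | — |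
| Tate's BSD for abelian varieties over number fields | `ord_{s=1} L(A/K,s) = rank A(K)` for every abelian variety `A/K` | strictly stronger (dimension `1`, `K = ℚ`) | Tate 1966 §1 Conj. (A); Tate 1974 §1 | `not typeable (missing notion: the Hasse–Weil L-function and the Mordell–Weil rank of `Literature.AbelianVariety K`; the tree links Weierstrass curves to abelian varieties only through the hypothesis structure `WeierstrassCurve.AbelianVarietyBridge`)` | none |
| Bloch–Kato Tamagawa number conjecture for the motive `h¹(E)(1)` (and Beilinson–Bloch for `H¹`) | `ord_{s=1} L(h¹(E),s) = dim H¹_f(ℚ, V) − dim H⁰`, leading term = Tamagawa measure | its rank clause is EQUIVALENT to RANK ∧ SHAFIN`[p^∞]` reformulated (Bloch–Kato 1990 §5), the whole conjecture strictly stronger | Bloch–Kato, Grothendieck Festschrift I (1990), Conj. 5.3 / 5.15 | `not typeable (missing notion: motivic cohomology / the Bloch–Kato Selmer group H¹_f of a p-adic Galois representation with its fundamental line; `Literature/NumberTheory/GaloisCohomology/BlochKatoForms*.lean` are Kato's differential-form symbols, not the TNC)` | none |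
| Tate's BSD over function fields (bsd.S33) | RANK for `E/𝔽_q(C)` (⟺ finiteness of `Ш`, Kato–Trihan 2003) | INCOMPARABLE (different base; the "geometric analog") | Tate 1966 §1 (B), Thm. 5.2; Ulmer 2011 | in tree (`Literature.NumberTheory.EllipticCurves.BSDFunctionFieldConjecture`), NOT registered | none |

Registered: 2 (`BSDConjecture` existing; `BSDRankConjectureNF` new). Bridges: 1 landed, 1 printed.
Equivalent criteria `E ↔ RANK` in print: none beyond tautologies (`(∀E, rank ≤ r_an) ∧ (∀E, r_an ≤ rank)`);
the landed `… → BirchSwinnertonDyer` assemblies of the routes (`higherGZ_assembly`, `SqueezeAssembly`,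
`LeadingTermAssembly`, `ShadowIsolation…`, `PAdicOrderV2Assembly`, …) conclude the summit from `Theses` cruxes,
which the tribunal scans itself and which are never tagged here (tagging a route crux would be circular).

## Deliberately NOT registered (and why)

* `ShaFiniteConjecture`, `ShaFiniteConjectureNF K`, `BSDLeadingTermConjecture`, `PAdicBSDConjecture W p D`,
  `BSDFunctionFieldConjecture`: incomparable with RANK in print (table). Registering an `H` that is not known
  to imply `P` would let `H → C` certify cruxes that are not summit-strength.
* PARAMETRISED predicates (not closed `Prop`s): `WeierstrassCurve.ShaFinite W`, `PAdicBSDConjecture W p D`,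
  `PAdicBSDConjectureExceptional W p …`, `SchneiderConjecture D` (`PAdicHeights.lean`), the Iwasawa-theoretic
  named facts `skinner_urban_main_conjecture`, `kato_divisibility` (THEOREMS in print under their hypotheses —
  literature debt, not open hypotheses).
* `Theses` decls of the summit's routes (e.g. `PAdicOrderV2.PAdicOrderMainConjectureR5/R7`, `SelmerRankUB`,
  `RankLeOne`, `SqueezeUBR2`): route cruxes are what the tribunal probes; never tagged.
* GRH for `L(E,s)` / for Rankin–Selberg convolutions, Goldfeld's average-rank conjecture, the
  Bhargava–Shankar/Bhargava–Skinner–Zhang density statements (`bhargava_skinner_zhang`, `AverageRankLE`):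
  statistical or analytic hypotheses that do not imply RANK for every curve.
* No summit-side conjecture `def` exists under `Summits/BirchSwinnertonDyer/**/Cruxes|Theorems` (searched
  `OPEN CONJECTURE`, `@[conjecture]`: no Lean hits outside `Theses`), so the summit file tags nothing in place.

## Not yet typeable

* BSD (rank clause) for abelian varieties over number fields (Tate 1966 (A)): needs `L(A/K,s)` and
  `rank A(K)` for `Literature.AbelianVariety`.
* Bloch–Kato / Beilinson–Bloch for `h¹(E)(1)`: needs `H¹_f`, motivic cohomology, determinant lines.
* Full refined BSD over a number field `K ≠ ℚ` (Tate 1966 (B); Gross Conj. 2.10 (2)): needs the period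
  `Ω(E/K)` over all archimedean places and `|d_K|^{-1/2}`; the tree's `bsdRHS` is over `ℚ` only. (Its RANK
  clause IS typeable and is `BSDRankConjectureNF` below.)

## Sources (all keys in `lean/references.bib`)

[Wiles2000] = [Wiles2006BSDClay] (Conjecture, Remarks 1, CMI offprint p. 2); [Tate1974] §1 (Conj. 1, Conj. 4);
[Tate1966Bourbaki] §1 (Conjectures (A), (B)), Thm. 5.2; [GrossPCMS2011] Conj. 2.10, Thm. 3.3; [SilvermanAEC2009]
VIII.8.3, X.4.13, App. C §16 (Conj. 16.1, Thm. 16.3, Conj. 16.5); [BCDTJAMS2001] Thm. A;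
[DokchitserDokchitserAnnals2010] Thm. 1.4; [MazurTateTeitelbaum1986Invent] §II.10; [BlochKato1990] §5;
[KatoTrihan2003].

## Design notes (readings fixed for `BSDRankConjectureNF`)

* `WeierstrassCurve.analyticRank W` (`AnalyticRank.lean`) is defined for `W` over any number field `K` as the
  order of vanishing at `s = 1` of `W.entireLFunction`, the (unique) entire continuation of `W.LSeries` from
  `re s > 3/2` — with a JUNK value when no entire continuation exists (`W.HasEntireLFunction` fails), which
  for `K ≠ ℚ` is the open continuation half of the Hasse–Weil conjecture (Silverman *AEC* Conj. C.16.1). Tate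
  (1966, §1) and Gross (2011, Lecture 2) state BSD over a global field for the analytically continued
  `L`-function; so the hypothesis `W.HasEntireLFunction` is made EXPLICIT per curve, and the statement asserts
  `r_an = rank` only where `r_an` is the printed quantity. This is formally WEAKER than "continuation ∧ RANK
  for all `E/K`" and still implies the summit, because over `ℚ` continuation is the named fact
  `WeierstrassCurve.hasEntireLFunction_rat` (BCDT 2001 Thm. A; reduced in tree to the leaves listed in
  `AnalyticRankBCDTTheoremBProofs`, not yet discharged) — whence the bridge is PRINTED, not landed.
* `K : Type` (universe `0`), as in `ShaFiniteConjectureNF`, so the statement is a closed `Prop` with no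
  universe parameter.
-/

noncomputable section

/-! ## Existing conjecture `def`s, tagged in place (no restatement) -/

attribute [strong_hypothesis "BirchSwinnertonDyer.BirchSwinnertonDyer"]
  Literature.NumberTheory.EllipticCurves.BSDConjecture

namespace Literature.StrongHypotheses.BirchSwinnertonDyer

/-! ## Strictly stronger, newly stated -/

/-- OPEN CONJECTURE — the **Birch–Swinnerton-Dyer rank conjecture over every number field**: for every
number field `K` and every elliptic curve `E/K` (Weierstrass equation `W` over `K` with `Δ ≠ 0`) whose
Hasse–Weil `L`-function `L(E/K, s)` extends to an entire function (`W.HasEntireLFunction`; conjectured for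
all `E/K`, Silverman *AEC* Conj. C.16.1, known over `ℚ` and in further cases), the order of vanishing of that
continuation at `s = 1` equals the Mordell–Weil rank: `ord_{s=1} L(E/K, s) = rank_ℤ E(K)`
(`W.analyticRank = W.mordellWeilRank`). Posed by Tate, *On the conjectures of Birch and Swinnerton-Dyer and
a geometric analog*, Sém. Bourbaki 306 (1966), §1, Conjecture (A), for abelian varieties over global fields
(here: dimension `1`, number fields), and in this form for elliptic curves over a global field `k` in Gross,
PCMS 18 (2011), Conjecture 2.10 (1). STRICTLY STRONGER than the summit `BirchSwinnertonDyer` (= its case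
`K = ℚ`, where `HasEntireLFunction` holds by Breuil–Conrad–Diamond–Taylor 2001, Thm. A — the named fact
`WeierstrassCurve.hasEntireLFunction_rat`); bridge PRINTED (summit file). Open: known for `K = ℚ` or `K`
totally real in analytic rank `≤ 1` (Gross–Zagier–Kolyvagin–Zhang, Gross Thm. 3.3), open in general even
over `ℚ`. Readings (explicit continuation hypothesis, `K : Type`) are fixed in the module docstring.
[cite: Tate1966Bourbaki, §1 Conjecture (A)] [status: open] -/
@[conjecture, strong_hypothesis "BirchSwinnertonDyer.BirchSwinnertonDyer"]
def BSDRankConjectureNF : Prop :=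
  ∀ (K : Type) [Field K] [NumberField K] (W : WeierstrassCurve K),
    W.IsElliptic → W.HasEntireLFunction → W.analyticRank = W.mordellWeilRank

end Literature.StrongHypotheses.BirchSwinnertonDyer
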